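import Summits.BirchSwinnertonDyer.BirchSwinnertonDyer.Theorems.SylvesterTwoHeegnerIndexCoupledTelescopeBottomLink
import Summits.BirchSwinnertonDyer.BirchSwinnertonDyer.Theorems.SylvesterTwoHeegnerIndexCoupledTelescopeAdmissibleLines
import Literature.NumberTheory.EllipticCurves.HeegnerPointsKolyvaginPrimaryLeavesProofs
import HarnessLib

/-!
# The COUPLED Cassels–Tate telescope, XLVII: the rows' bottom class `c_B(1) = 2^{M₀} • δ x₀` lies in
# `Adm_B` (RESIDUE c v3 l.82 at `n = 1`; crux `UpperOffV0HSYPlus`, stmt-BirchSwinnertonDyer-19804; plan (B) file B-V′)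

With `Adm_B := {x | ∃ y, (∃ ε, σ_* y = ε • y) ∧ x ∈ closure {y, w_B y} ∧ y ∈ closure {x, w_B x}}`
(`…CoupledTelescopeAdmissibleLines`), the rows' bottom class `2^{M₀} • δ x₀` — `x₀` from RESIDUE 4's ANONYMOUS
`Y` through `Y^tr = 2^{M₀} • x₀ + T` — is admissible WITHOUT any height input: `E_p(K)` has `𝒪`-rank one, so
(T6)'s odd line gives `n • Y^tr = 2^e (a″ • P″ + b″ • θ P″) + T′` with `n` odd, `a″, b″` not both even and
`P″` the transported RATIONAL generator; applying `δ` (`δ θ = −δ − w δ`, `δ(torsion) = 0`) puts `2^{M₀} • δ x₀`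
on the `𝒪`-line of the σ-FIXED class `2^e • δ P″` with an odd-norm unit (`mem_admLines_of_odd_zsmul_eq`);
if `a″ = b″ = 0` cannot occur (not both even), and the degenerate `a = b = 0` makes the class `0`.
* ★ `bottomClass_mem_admLines`.
Theorem only (no definition / named fact / instance / notation); nothing asserted on 19804; no stub closed;
X12.CMAtTwo NOT proved; BSD not claimed for any curve.  Sources: [GrossLMS1991] §4 (4.4), §5 (5.1);
[HuShuYin2019] §2 p. 8; [IrelandRosen1990] Ch. 9 §1.  `lean search 'bottomClass_mem_admLines'` → nothing before.
-/

-- every Summits module is named `Summit.<Summit>.<Problem>…`: the duplicated component is by design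
set_option linter.dupNamespace false
set_option autoImplicit false

noncomputable section

open scoped Classical

open WeierstrassCurve WeierstrassCurve.Affine WeierstrassCurve.Affine.Point NumberField IsDedekindDomain
  Literature.NumberTheory.EllipticCurves Literature.NumberTheory.EllipticCurves.HuShuYin2019
  Literature.NumberTheory.EllipticCurves.KolyvaginCocycle Literature.NumberTheory.QuadraticFields
  Literature.NumberTheory.EllipticCurves.ModularForms

namespace Summit.BirchSwinnertonDyer.BirchSwinnertonDyer.Theorems.SylvesterTwoCoupledTelescope

open Summit.BirchSwinnertonDyer.BirchSwinnertonDyer.Theorems.SylvesterTwoCMNormForm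
  Summit.BirchSwinnertonDyer.BirchSwinnertonDyer.Theorems.SylvesterTwoCoupledDescentPrimitivity
  Summit.BirchSwinnertonDyer.BirchSwinnertonDyer.Theorems.SylvesterTwoCMFlip
  Summit.BirchSwinnertonDyer.BirchSwinnertonDyer.Theorems.SylvesterTwoFrame
  Summit.BirchSwinnertonDyer.BirchSwinnertonDyer.Theses.SylvesterTwoHeegnerIndex

variable {K : Type} [Field K] [NumberField K]

set_option maxHeartbeats 1600000 in
/-- ★ **`c_B(1) = 2^{M₀} • δ x₀ ∈ Adm_B`** (RESIDUE c v3 l.82 at `n = 1`, for the rows' `Adm_B` = `𝒪`-lines of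
σ-eigenclasses): binders = RESIDUE 4's bottom binders (`P`, anonymous `Y`, `M₀, x₀, T` with `Y^tr = 2^{M₀} • x₀ + T`),
the level `nl = 2^M` with its `hdiv`, the display's `φ_B`/`fn_B`, any `c ∈ Aut(K/ℚ)`; no height input.
[cite: GrossLMS1991, §4 (4.4), §5 (5.1)] [cite: HuShuYin2019, §2 p. 8] -/
theorem bottomClass_mem_admLines (hF : PublishedFactsTwoPlus)
    {p : ℕ} (hp : p.Prime) (h9 : p % 9 = 4) (h3 : ¬ ∃ x : ZMod p, x ^ 3 = 3)
    (A B : WeierstrassCurve ℚ) [A.IsElliptic] [A.IsGloballyMinimal] [B.IsElliptic] [B.IsGloballyMinimal]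
    (hA : ∃ C : VariableChange ℚ, C • A = HuShuYin2019.cubeSumCurve (3 * (p : ℚ) ^ 2))
    {ω : K} (hω : ω ^ 2 + ω + 1 = 0) (h2 : Module.finrank ℚ K = 2) (c : K ≃ₐ[ℚ] K)
    (CB : VariableChange ℚ) (hCB : CB • B = HuShuYin2019.cubeSumCurve (p : ℚ))
    (P : B.toAffine.Point) (Y : (B.baseChange K).toAffine.Point)
    (hPinf : ¬ IsOfFinAddOrder (WeierstrassCurve.QuadraticDescent.incl K B P))
    (hPgen : ∀ Q : B.toAffine.Point, ∃ m : ℤ, IsOfFinAddOrder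
      (WeierstrassCurve.QuadraticDescent.incl K B Q - m • WeierstrassCurve.QuadraticDescent.incl K B P))
    {M₀ : ℕ} {x₀ T : ((cubeSumCurve (p : ℚ)).baseChange K).toAffine.Point} (hT : IsOfFinAddOrder T)
    (hY : Affine.Point.congrEquiv (congrArg (fun W : WeierstrassCurve ℚ ↦ W.baseChange K) hCB)
      (VariableChange.pointEquivBaseChange B CB K Y) = ((2 ^ M₀ : ℕ) : ℤ) • x₀ + T)
    -- the level
    {M : ℕ} (nl : ℕ) (hn : nl = 2 ^ M)
    (hdiv : ∀ X : geomPoints ((cubeSumCurve (p : ℚ)).baseChange K),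
      ∃ R : geomPoints ((cubeSumCurve (p : ℚ)).baseChange K), ((nl : ℕ) : ℤ) • R = X)
    -- the display's CM operator on `B_K` and its restriction to `B_K[nl]`
    (φB : Isogeny ((cubeSumCurve (p : ℚ)).baseChange K) ((cubeSumCurve (p : ℚ)).baseChange K))
    (fnB : geomTorsion ((cubeSumCurve (p : ℚ)).baseChange K) ((nl : ℕ) : ℤ) →+
      geomTorsion ((cubeSumCurve (p : ℚ)).baseChange K) ((nl : ℕ) : ℤ))
    (hfnB : ∀ (g : Field.absoluteGaloisGroup K) (Q : geomTorsion ((cubeSumCurve (p : ℚ)).baseChange K) ((nl : ℕ) : ℤ)),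
      fnB (ContinuousMonoidHom.id _ g • Q) = g • fnB Q)
    (hφB : ∀ (x y : AlgebraicClosure K)
      (h : (((cubeSumCurve (p : ℚ)).baseChange K).baseChange (AlgebraicClosure K)).toAffine.Nonsingular x y),
      ∃ h', φB (Affine.Point.some x y h) =
        Affine.Point.some (algebraMap K (AlgebraicClosure K) ω ^ 2 * x) (algebraMap K (AlgebraicClosure K) ω ^ 3 * y) h')
    (hcoeB : ∀ Q : geomTorsion ((cubeSumCurve (p : ℚ)).baseChange K) ((nl : ℕ) : ℤ),
      ((fnB Q : geomTorsion ((cubeSumCurve (p : ℚ)).baseChange K) ((nl : ℕ) : ℤ)) :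
        geomPoints ((cubeSumCurve (p : ℚ)).baseChange K)) = φB Q) :
    ((2 : ℤ) ^ M₀) • kummerMapTorsion ((cubeSumCurve (p : ℚ)).baseChange K) ((nl : ℕ) : ℤ) hdiv x₀ ∈
      {x : galH1Torsion ((cubeSumCurve (p : ℚ)).baseChange K) ((nl : ℕ) : ℤ) |
        ∃ y, (∃ ε : ℤ, conjAct (cubeSumCurve (p : ℚ)) c ((nl : ℕ) : ℤ) y = ε • y) ∧
          x ∈ AddSubgroup.closure ({y, resH1Hom (ContinuousMonoidHom.id _) fnB hfnB y} : Set _) ∧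
          y ∈ AddSubgroup.closure ({x, resH1Hom (ContinuousMonoidHom.id _) fnB hfnB x} : Set _)} := by
  subst hn
  have hp2 : p ≠ 2 := by rintro rfl; norm_num at h9
  have hp0 : p ≠ 0 := hp.ne_zero
  have hp0' : (p : ℚ) ≠ 0 := by exact_mod_cast hp0
  have hζ : IsPrimitiveRoot ω 3 := (JZero.exists_aut_apply_eq_sq K hω h2).1
  have hB : ∃ C : VariableChange ℚ, C • B = HuShuYin2019.cubeSumCurve (p : ℚ) := ⟨CB, hCB⟩
  haveI hB₀ : ((cubeSumCurve (p : ℚ)).baseChange K).IsElliptic := isElliptic_cubeSumCurve_baseChange K hp0'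
  haveI hBK : (B.baseChange K).IsElliptic := inferInstanceAs (B.map (algebraMap ℚ K)).IsElliptic
  -- ### the short model `B₀ = E_p ⊗ K`: `a₁ = a₂ = a₃ = a₄ = 0`, the CM rotation `θ`, no `2`-torsion
  have ha1 : ((cubeSumCurve (p : ℚ)).baseChange K).a₁ = 0 := by simp [cubeSumCurve, WeierstrassCurve.baseChange]
  have ha2 : ((cubeSumCurve (p : ℚ)).baseChange K).a₂ = 0 := by simp [cubeSumCurve, WeierstrassCurve.baseChange]
  have ha3 : ((cubeSumCurve (p : ℚ)).baseChange K).a₃ = 0 := by simp [cubeSumCurve, WeierstrassCurve.baseChange]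
  have ha4 : ((cubeSumCurve (p : ℚ)).baseChange K).a₄ = 0 := by simp [cubeSumCurve, WeierstrassCurve.baseChange]
  obtain ⟨θ, hθ⟩ := exists_omegaRot (W := (cubeSumCurve (p : ℚ)).baseChange K) hω ha1 ha2 ha3 ha4
  have hθ0 : (θ : _ → _) 0 = 0 := map_zero θ
  have hθ3 : ∀ X, θ.toAddMonoidHom (θ.toAddMonoidHom X) + θ.toAddMonoidHom X + X = 0 := fun X ↦
    omegaRot_omegaRot_add_omegaRot_add hω ha1 ha2 ha3 ha4 hθ0 hθ (omega_ne_one hω) X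
  have h2tor : ∀ X : ((cubeSumCurve (p : ℚ)).baseChange K).toAffine.Point, 2 • X = 0 → X = 0 :=
    two_torsion_eq_zero_cubeSumCurve_of_finrank_eq_two K h2 hp hp2
  -- ### the transport `e : B(K) ≃ B₀(K)`, the generator `P″`
  set φv := VariableChange.pointEquivBaseChange B CB K with hφv
  set ψc := Affine.Point.congrEquiv (congrArg (fun W : WeierstrassCurve ℚ ↦ W.baseChange K) hCB) with hψc
  obtain ⟨P'', hP''⟩ : ∃ P'' : ((cubeSumCurve (p : ℚ)).baseChange K).toAffine.Point,
      P'' = ψc (φv (QuadraticDescent.incl K B P)) := ⟨_, rfl⟩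
  have hP''inf : ¬ IsOfFinAddOrder P'' := fun h ↦ by
    rw [hP''] at h
    exact hPinf ((φv.trans ψc).injective.isOfFinAddOrder_iff (f := (φv.trans ψc).toAddMonoidHom) |>.mp h)
  -- ### `P″` is RATIONAL: fixed by `c`
  have hmapψ : ∀ {E : WeierstrassCurve ℚ} (hE : CB • B = E) (X : ((CB • B).baseChange K).toAffine.Point),
      Affine.Point.map (W' := E) (c : K →ₐ[ℚ] K)
          (Affine.Point.congrEquiv (congrArg (fun W : WeierstrassCurve ℚ ↦ W.baseChange K) hE) X) =
        Affine.Point.congrEquiv (congrArg (fun W : WeierstrassCurve ℚ ↦ W.baseChange K) hE)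
          (Affine.Point.map (W' := CB • B) (c : K →ₐ[ℚ] K) X) := by
    intro E hE X
    subst hE
    rfl
  have hcP'' : Affine.Point.map (W' := cubeSumCurve (p : ℚ)) (c : K →ₐ[ℚ] K) P'' = P'' := by
    rw [hP'', hψc, hmapψ hCB, hφv, VariableChange.pointEquivBaseChange_map]
    exact congrArg _ (congrArg _ (WeierstrassCurve.QuadraticDescent.conjMap_incl B (c : K →ₐ[ℚ] K) P))
  -- ### `P″ ∉ 2 B₀(K) + tors` ((T6)'s descent along the conjugation of `K/ℚ`, on `(CB • B)_K`, transported)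
  haveI hCBK : ((CB • B).baseChange K).IsElliptic := inferInstanceAs ((CB • B).map (algebraMap ℚ K)).IsElliptic
  obtain ⟨θ₀, cc, hθ₀, hcc⟩ := Quadratic.exists_sq_eq_algebraMap (F := ℚ) (K := K) h2
  have h2tor' : ∀ X : ((CB • B).baseChange K).toAffine.Point, 2 • X = 0 → X = 0 :=
    two_torsion_eq_zero_of_model_of_finrank_eq_two K h2 hp hp2 (CB • B) ⟨1, by rw [one_smul, hCB]⟩
  have hσσ : ∀ X, WeierstrassCurve.QuadraticDescent.conjMap (CB • B) (Quadratic.conj h2 hθ₀ hcc)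
      (WeierstrassCurve.QuadraticDescent.conjMap (CB • B) (Quadratic.conj h2 hθ₀ hcc) X) = X :=
    WeierstrassCurve.QuadraticDescent.conjMap_conjMap (CB • B) (Quadratic.conj_conj h2 hθ₀ hcc)
  have hσP : WeierstrassCurve.QuadraticDescent.conjMap (CB • B) (Quadratic.conj h2 hθ₀ hcc)
      (φv (QuadraticDescent.incl K B P)) = φv (QuadraticDescent.incl K B P) := by
    rw [hφv]
    show Affine.Point.map _ (VariableChange.pointEquivBaseChange B CB K _) = _
    rw [VariableChange.pointEquivBaseChange_map]
    exact congrArg (VariableChange.pointEquivBaseChange B CB K)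
      (WeierstrassCurve.QuadraticDescent.conjMap_incl B (Quadratic.conj h2 hθ₀ hcc) P)
  have hPinf' : ¬ IsOfFinAddOrder (φv (QuadraticDescent.incl K B P)) := fun h ↦
    hPinf ((φv.injective.isOfFinAddOrder_iff (f := φv.toAddMonoidHom)).mp h)
  have hP2' : ¬ ∃ (Q T' : ((CB • B).baseChange K).toAffine.Point), IsOfFinAddOrder T' ∧
      φv (QuadraticDescent.incl K B P) = 2 • Q + T' :=
    not_exists_eq_two_smul_add_torsion
      (WeierstrassCurve.QuadraticDescent.conjMap (CB • B) (Quadratic.conj h2 hθ₀ hcc)) hσσ h2tor' hPinf' hσP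
      (fun X hX ↦ descends_of_generator h2 hθ₀ hcc B CB hPgen X hX)
  have hP2 : ¬ ∃ (Q T' : ((cubeSumCurve (p : ℚ)).baseChange K).toAffine.Point), IsOfFinAddOrder T' ∧ P'' = 2 • Q + T' := by
    rintro ⟨Q, T', hT', hQ⟩
    refine hP2' ⟨ψc.symm Q, ψc.symm T', ψc.symm.toAddMonoidHom.isOfFinAddOrder hT', ?_⟩
    apply ψc.injective
    rw [map_add, map_nsmul, ψc.apply_symm_apply, ψc.apply_symm_apply, ← hQ, hP'']
  -- ### rank 2
  obtain ⟨-, -, -, -, -, hrank, -⟩ := hF.2 p hp (Or.inl h9) h3 A B hB hA K ω hω h2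
  have hr : Module.finrank ℤ ((cubeSumCurve (p : ℚ)).baseChange K).toAffine.Point = 2 := by
    rw [← (φv.trans ψc).toIntLinearEquiv.finrank_eq]; exact hrank
  -- ### the Kummer map `δ`, the operator `w_B = H¹(fn_B)`, `w² + w + 1 = 0`
  have hrelB : ∀ Q, fnB (fnB Q) + fnB Q + Q = 0 := JZero.torsion_hrel_of_formula
    (SylvesterTwoCoupledDescentF4Package.baseChange_eq_of_a_eq_zero (K := K) (cubeSumCurve (p : ℚ)) rfl rfl rfl rfl)
    hζ φB hφB _ fnB hcoeB
  have hrel := resH1Hom_id_apply_apply_add _ fnB hfnB hrelB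
  have hmt : ∀ t : galH1Torsion ((cubeSumCurve (p : ℚ)).baseChange K) (((2 ^ M : ℕ) : ℤ)), (((2 ^ M : ℕ) : ℤ)) • t = 0 :=
    fun t ↦ zsmul_galH1Torsion_eq_zero _ _ t
  have hδtor : ∀ {X : ((cubeSumCurve (p : ℚ)).baseChange K).toAffine.Point}, IsOfFinAddOrder X →
      kummerMapTorsion ((cubeSumCurve (p : ℚ)).baseChange K) (((2 ^ M : ℕ) : ℤ)) hdiv X = 0 := fun hX ↦
    kummerMapTorsion_eq_zero_of_isOfFinAddOrder h2 hp hp2 (2 ^ M) rfl hdiv hX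
  have hδθ : ∀ Q, kummerMapTorsion ((cubeSumCurve (p : ℚ)).baseChange K) (((2 ^ M : ℕ) : ℤ)) hdiv (θ Q) =
      -kummerMapTorsion ((cubeSumCurve (p : ℚ)).baseChange K) (((2 ^ M : ℕ) : ℤ)) hdiv Q -
        resH1Hom (ContinuousMonoidHom.id _) fnB hfnB (kummerMapTorsion ((cubeSumCurve (p : ℚ)).baseChange K) (((2 ^ M : ℕ) : ℤ)) hdiv Q) :=
    kummerMapTorsion_omegaRot hω ha1 ha2 ha3 ha4 _ φB.toAddMonoidHom φB.equivariant hφB fnB hfnB hcoeB hrel hdiv hθ0 hθ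
  -- `δ P″` is `σ`-fixed
  have heig : ∃ ε : ℤ, conjAct (cubeSumCurve (p : ℚ)) c (((2 ^ M : ℕ) : ℤ))
      (kummerMapTorsion ((cubeSumCurve (p : ℚ)).baseChange K) (((2 ^ M : ℕ) : ℤ)) hdiv P'') =
        ε • kummerMapTorsion ((cubeSumCurve (p : ℚ)).baseChange K) (((2 ^ M : ℕ) : ℤ)) hdiv P'' :=
    ⟨1, by rw [one_smul, conjAct_kummerMapTorsion, hcP'']⟩
  -- ### the bottom point on the `K`-line of `P″` with an ODD denominator
  obtain ⟨n₀, a₀, b₀, hn₀, hY₀⟩ := exists_zsmul_eq_of_finrank_eq_two hω ha1 ha2 ha3 ha4 hθ0 hθ hr hP''inf (ψc (φv Y))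
  obtain ⟨n, a, b, T', hodd, hT', hYn⟩ := exists_odd_zsmul_eq θ.toAddMonoidHom hθ3 P'' hP2
    n₀.natAbs le_rfl hn₀ IsOfFinAddOrder.zero hY₀
  have hn : n ≠ 0 := by rintro rfl; exact hodd ⟨0, rfl⟩
  have hoddn : Odd n := Int.not_even_iff_odd.mp (fun h ↦ hodd (even_iff_two_dvd.mp h))
  -- the class `x = 2^{M₀} • δ x₀ = δ (Y^tr)`
  have hx : ((2 : ℤ) ^ M₀) • kummerMapTorsion ((cubeSumCurve (p : ℚ)).baseChange K) (((2 ^ M : ℕ) : ℤ)) hdiv x₀ =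
      kummerMapTorsion ((cubeSumCurve (p : ℚ)).baseChange K) (((2 ^ M : ℕ) : ℤ)) hdiv (ψc (φv Y)) := by
    rw [hY, map_add, hδtor hT, add_zero, map_zsmul]; push_cast; rfl
  by_cases hab : a = 0 ∧ b = 0
  · -- degenerate line: `n • Y^tr` is torsion, so the class is `0`
    obtain ⟨rfl, rfl⟩ := hab
    have hYtor : IsOfFinAddOrder (ψc (φv Y)) := by
      rw [zero_smul, zero_smul, zero_add, zero_add] at hYn
      obtain ⟨k, hk, hk0⟩ := (isOfFinAddOrder_iff_nsmul_eq_zero).mp hT'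
      rw [isOfFinAddOrder_iff_zsmul_eq_zero]
      refine ⟨(k : ℤ) * n, mul_ne_zero (by exact_mod_cast hk.ne') hn, ?_⟩
      rw [mul_smul, hYn, natCast_zsmul, hk0]
    rw [hx, hδtor hYtor]
    exact zero_mem_admLines (cubeSumCurve (p : ℚ)) c _ _
  · -- ### split `a = 2^e a″`, `b = 2^e b″` (`a″, b″` not both even) and apply `δ`
    obtain ⟨e, a'', b'', rfl, rfl, hab''⟩ := exists_two_pow_split _ a b le_rfl hab
    have hnY : n • kummerMapTorsion ((cubeSumCurve (p : ℚ)).baseChange K) (((2 ^ M : ℕ) : ℤ)) hdiv (ψc (φv Y)) =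
        (a'' - b'') • ((2 : ℤ) ^ e • kummerMapTorsion ((cubeSumCurve (p : ℚ)).baseChange K) (((2 ^ M : ℕ) : ℤ)) hdiv P'') +
          (-b'') • resH1Hom (ContinuousMonoidHom.id _) fnB hfnB
            ((2 : ℤ) ^ e • kummerMapTorsion ((cubeSumCurve (p : ℚ)).baseChange K) (((2 ^ M : ℕ) : ℤ)) hdiv P'') := by
      rw [← map_zsmul, hYn, map_add, map_add, hδtor hT', add_zero, map_zsmul, map_zsmul]
      change _ + _ • kummerMapTorsion _ _ hdiv (θ P'') = _
      rw [hδθ, map_zsmul, ← mul_zsmul, ← mul_zsmul, zsmul_sub, zsmul_neg,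
        show (a'' - b'') * (2 : ℤ) ^ e = 2 ^ e * a'' - 2 ^ e * b'' by ring,
        show -b'' * (2 : ℤ) ^ e = -(2 ^ e * b'') by ring, sub_zsmul, neg_zsmul]
      abel
    rw [hx]
    exact mem_admLines_of_odd_zsmul_eq (resH1Hom (ContinuousMonoidHom.id _) fnB hfnB) hrel (2 ^ M) M hmt dvd_rfl
      (E := fun y ↦ ∃ ε : ℤ, conjAct (cubeSumCurve (p : ℚ)) c (((2 ^ M : ℕ) : ℤ)) y = ε • y)
      (zsmul_mem_admSet (cubeSumCurve (p : ℚ)) c _ heig ((2 : ℤ) ^ e)) hoddn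
      (fun h ↦ hab'' (by
        obtain ⟨h1, h2⟩ := h
        have hb : (2 : ℤ) ∣ b'' := dvd_neg.mp h2
        have ha : (2 : ℤ) ∣ a'' := by have := dvd_add h1 hb; rwa [sub_add_cancel] at this
        exact ⟨ha, hb⟩)) hnY

end Summit.BirchSwinnertonDyer.BirchSwinnertonDyer.Theorems.SylvesterTwoCoupledTelescope

end
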